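import Summits.QuantumFields.YangMills.Theorems.BalabanUVNodesClustersCore
import Literature.MathematicalPhysics.QuantumFieldTheory.Balaban1983to89.Node00.Record11CarriersB8
import Literature.MathematicalPhysics.QuantumFieldTheory.Balaban1983to89.Node00.CarriersB10Prime

/-!
# BalabanUVNodes ∕ N08 AT THE STAGE-11 RECORD — THE SIDE FACES: (A) the PRIMED reading of N08 at the [B8]-keyed pinned record `Node00.IsRecordOfRecord₁₁CB10YZWB8` (S1 ⇒ primed
# ONLY), and (B) WHY N08's KEY AT ₁₁ IS THE PINNED RECORD — over the route's own `Rec = Node00.IsRecordOfRecord₁₁C` the [B10] run family is still the FREE residual field `θ.res.X`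
# of `θ.toStage5₁₁`, so `S_N08 (IsRecordOfRecord₁₁C F N)` is junk-provable-or-refutable as typed (the ₁₁ twin of n08-a's `B10LeafUnpinnedRecord5C` §0–§3, under ₁₁C-inhabitation
# at the family as HYPOTHESIS) (Track A, DAG node N08 [Balaban1985UV3] CMP 102 (1985) 255, Thm 1 p. 257 (compact reading) + Thm 2 p. 272; cluster K3; R134 fan-out seat
# `pub-ymgap-dag-n08-c` strategy s2, dag-lead FAN-OUT v1.1 §N08 s2, 2026-08-26; companion of `BalabanUVNodesN08AtRecord11` = the readings ∕ closers ∕ supplier face at the pinned keys)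

HONEST FRAMING.  Count-neutral kernel bookkeeping BY NAME over LANDED modules: def-T's `Node00.Record11` (`IsRecordOfRecord₁₁C`, `atWorld_of_isRecordOfRecord₁₁C`), node00-def g31's
`Node00.Record11Carriers` (`Stage11Params.rebindX`, `datumOfRecord₁₁_rebindX`) ∕ `Record11CarriersB8` (`IsRecordOfRecord₁₁CB10YZWB8`, `leaves_iff_of_…`, `b8_b11_b10_main_iff_of_…`,
`nodes_iff_bundles_of_…`), g29's slot of record `Node00.PrintedUV3V` + `Node00.upOfRecord₅C_b10_iff` (`CarriersB10` ∕ `Record5C`), g31's `Node00.CarriersB10Prime` v1.1 (the primed slot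
`PrintedUV3V'`, R451 (C2)'s arrow `printedUV3V'_of_printedUV3V`, `not_loopLinearised_trivial`), NODE 00's ₅C in-edge theorems (`b4∕b5∕b7_main_of_isRecordOfRecord₅C`, `N03_at_record₅C`)
and `Node00.nonempty_printedCarriersR`.  NOT A DISCHARGE OF N08 and NOT A RE-POINT: the `b10` leaf of every record predicate still reads S1 = `Node00.PrintedUV3V N L` (chair R451
(C2)); the primed slot is displayed as a SIDE FACE in ONE direction only (S1 ⇒ primed, by g31's arrow) — THE CONVERSE `PrintedUV3V' → PrintedUV3V` IS NOT CLAIMED.  The AXIAL ∕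
decimation averaging of the closed d = 3 lane is EXCLUDED from the primed slot's admissible class for `N ≥ 2`: g31's `Node00.not_loopLinearised_trivial` (CITED, not restated —
dag-lead DEDUP-113).  (B)'s records are DEGENERATE probes of the TYPING (junk carrier bundles re-bound into a given record's parameters), not objects of record; ₁₁C-inhabitation at
the family (the route's K0 `Record11Inhabited` there, N = 2) is an explicit HYPOTHESIS, never asserted.  Nothing of Bałaban's asserted; one finite torus per run at fixed spacing;
nothing continuum ∕ ℝ³ ∕ ℝ⁴ ∕ OS ∕ mass gap ∕ Clay.  0 `sorry`, 0 `def`, 0 `instance`, standard axioms.  Filed `--supports` item K1 `StabilityBAtRecordR11e` (stmt-QuantumFields-19674)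
of route «BalabanUVNodes» rev 1.

WHAT THIS FILE PROVES.
* §A PRIMED SIDE FACES at the [B8] key (chair R451 (R-b) ∕ (C2), R454; the ₁₁ twins of n08-a g7's (P5) faces): `b10_main_imp_primed_residual ∕ _bundles_of_isRecordOfRecord₁₁CB10YZWB8`
  (at one record, at every run: `Dag.B10_main →` «`b8 → b9 → b11 → Node00.PrintedUV3V' N L`», resp. through the bundles of record with `B8LeafOfRecord θ₃ lam` DISPLAYED — ref-C
  (B8-2)), `s_N08_record₁₁CB10YZWB8_imp_primed` (the ∀-sentence implies its primed reading), `printedUV3V'_of_s_N08_record₁₁CB10YZWB8` (under inhabitation the closer of record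
  reads the PRIMED slot back too).
* §B WHY THE KEY IS THE PINNED RECORD (₁₁ twin of `B10LeafUnpinnedRecord5C` §0–§3, via `Stage11Params.rebindX`): `guards_of_isRecordOfRecord₁₁C` (`b4 b5 b6 b7` HOLD at every
  ₁₁C record — N01 ∕ N02 ∕ N03 ∕ N04 at the ₅C shadow, def-T's `atWorld` transfer), `provisos₁₁_rebindX` (the provisos read no carrier: field-by-field transport, the shape of g31's
  `Provisos₁₁.pinB10` at a generic `X′`), `admissible_rebindX_iff` (`Iff.rfl`), `exists_isRecordOfRecord₁₁C_b10_iff` (given ONE ₁₁C record at `F`, EVERY bundle `Xc` is the residual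
  `X` of a ₁₁C record with the SAME datum, whose `b10` leaf is the compact node over `Xc`'s runs), `exists_isRecordOfRecord₁₁C_not_b10 ∕ _b10` (a record where `b10` FAILS ∕ HOLDS
  degenerately at every run), `exists_isRecordOfRecord₁₁C_sisters_imp_not_b10_main` + `not_s_N08_record₁₁C_of_sisters` (there N08 fails as soon as N05 N06 N07 hold),
  `b10_main_undetermined_over_record₁₁C` — N08's currency at ₁₁ is the pinned key, whose records ARE ₁₁C records and whose `b10` leaf IS the slot of record.
-/

noncomputable section

namespace Summit.QuantumFields.YangMills.BalabanUVNodes.N08AtRecord11Sides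

open Literature.MathematicalPhysics.QuantumFieldTheory.Balaban1983to89
open Literature.MathematicalPhysics.QuantumFieldTheory.Balaban1983to89.T4Continuum (T4Family FiniteEpsData)
open Literature.MathematicalPhysics.QuantumFieldTheory.Balaban1983to89.DagBinding (WorldP leavesP B9LeafX B11Leaf PrintedCarriersR)
open Literature.MathematicalPhysics.QuantumFieldTheory.Balaban1983to89.Node00
open YMDAG.UVSplit (RecordPred Datum AtRecord S_N05 S_N06 S_N07 S_N08)

variable {N : ℕ} [NeZero N]

/-! ## §A PRIMED SIDE FACES at the [B8] key — direction S1 ⇒ primed ONLY (no record predicate's `b10` is re-pointed; the converse is NOT claimed) -/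

section Primed

variable {F : T4Family} {D : Datum F N} {w : WorldP}

/-- **N08 at a [B8]-keyed Stage-11 record IMPLIES ITS PRIMED RESIDUAL READING** (side face, one direction): with `L` the world's block size, at every run `Dag.B10_main (leavesP w P)` gives
«`b8 → b9 → b11 → Node00.PrintedUV3V' N L`» — g31's `b8_b11_b10_main_iff_of_…` (the in-edges `b5 b6 b7` are theorems of the record), the `b10` leaf read as the slot of record
(`leaves_iff_of_…`), then R451 (C2)'s arrow `printedUV3V'_of_printedUV3V`.  The converse is NOT claimed: the leaf reads S1.
[cite: Balaban1985UV3, Thm 1 p.257 (compact reading) and Thm 2 p.272, p.256 L10; Balaban1987RG1, (0.4)–(0.9) p.253 (bookkeeping)] -/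
theorem b10_main_imp_primed_residual_of_isRecordOfRecord₁₁CB10YZWB8 (h : IsRecordOfRecord₁₁CB10YZWB8 F N D w) :
    ∃ L : ℕ, (Odd L ∧ 1 < L) ∧ w.L = (L : ℝ) ∧ ∀ P : B12.RunParams,
      Dag.B10_main (leavesP w P) → (leavesP w P).b8 → (leavesP w P).b9 → (leavesP w P).b11 → PrintedUV3V' N L := by
  obtain ⟨θ, _, _, _, _, _, -, hwL, hl⟩ := leaves_iff_of_isRecordOfRecord₁₁CB10YZWB8 h
  refine ⟨θ.L, θ.hL, hwL, fun P H h8 h9 h11 => printedUV3V'_of_printedUV3V N θ.L ?_⟩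
  exact (hl P).2.2.2.1.1 ((b8_b11_b10_main_iff_of_isRecordOfRecord₁₁CB10YZWB8 h P).2.2.1 H h8 h9 h11)

/-- **N08 at a [B8]-keyed Stage-11 record IMPLIES ITS PRIMED READING THROUGH THE BUNDLES OF RECORD** (side face, one direction; ref-C (B8-2): `B8LeafOfRecord` DISPLAYED): for one
package `(θ, lam, Mstar, ops, ζ)`, at every run `Dag.B10_main (leavesP w P)` gives «`B8LeafOfRecord θ₃ lam → B9LeafX (Y9OfRecord N θ₃ Mstar ops) → B11Leaf (Z11OfRecord F N ζ) →
Node00.PrintedUV3V' N θ.L`» (g31's `nodes_iff_bundles_of_…` + the arrow).  The converse is NOT claimed.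
[cite: Balaban1985UV3, Thm 1 p.257 + Thm 2 p.272; Balaban1985RegularSpaces, Thm 8 p.101; Balaban1985BackgroundPropagators, Thm 3.1 p.397; Balaban1985Variational, Thm 1 p.279; Balaban1987RG1, (0.4)–(0.9) p.253 (bookkeeping)] -/
theorem b10_main_imp_primed_bundles_of_isRecordOfRecord₁₁CB10YZWB8 (h : IsRecordOfRecord₁₁CB10YZWB8 F N D w) :
    ∃ (θ : Stage11Params F N) (lam : ResidB8 θ.toStage3Params) (Mstar : ℕ) (ops : OpsY N θ.toStage3Params Mstar) (ζ : ResidZ F N),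
      θ.Admissible ∧ w.L = (θ.L : ℝ) ∧ ∀ P : B12.RunParams,
        Dag.B10_main (leavesP w P) →
          B8LeafOfRecord θ.toStage3Params lam → B9LeafX (Y9OfRecord N θ.toStage3Params Mstar ops) → B11Leaf (Z11OfRecord F N ζ) →
            PrintedUV3V' N θ.L := by
  obtain ⟨θ, lam, Mstar, ops, ζ, hθ, hL, hl⟩ := nodes_iff_bundles_of_isRecordOfRecord₁₁CB10YZWB8 h
  exact ⟨θ, lam, Mstar, ops, ζ, hθ, hL, fun P H h8 h9 h11 => printedUV3V'_of_printedUV3V N θ.L (((hl P).2.2).1 H h8 h9 h11)⟩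

/-- **THE ∀-SENTENCE AT THE [B8] KEY IMPLIES ITS PRIMED READING** (side face, one direction): `S_N08 (IsRecordOfRecord₁₁CB10YZWB8 F N)` ⇒ «at every such record, at its block size `L`,
at every run where `b8 b9 b11` hold, `Node00.PrintedUV3V' N L`».  The converse is NOT claimed. [cite: Balaban1985UV3, Thm 1 p.257 (compact reading) and Thm 2 p.272; Balaban1987RG1, (0.4)–(0.9) p.253 (bookkeeping)] -/
theorem s_N08_record₁₁CB10YZWB8_imp_primed (hS : S_N08 (fun F D w => IsRecordOfRecord₁₁CB10YZWB8 F N D w)) :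
    ∀ (F : T4Family) (D : Datum F N) (w : WorldP), IsRecordOfRecord₁₁CB10YZWB8 F N D w → ∀ L : ℕ, w.L = (L : ℝ) →
      ∀ P : B12.RunParams, (leavesP w P).b8 → (leavesP w P).b9 → (leavesP w P).b11 → PrintedUV3V' N L := by
  intro F D w h L hL P h8 h9 h11
  obtain ⟨L₀, -, hL₀, H⟩ := b10_main_imp_primed_residual_of_isRecordOfRecord₁₁CB10YZWB8 h
  have hLL : L₀ = L := by exact_mod_cast hL₀.symm.trans hL
  subst hLL
  exact H P (hS F D w h P) h8 h9 h11

/-- **Under inhabitation the [B8]-keyed closer of record reads the PRIMED slot back too**: if `S_N08` holds at the key and some such record has block size `L` and a run at which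
`b8 b9 b11` hold, then `Node00.PrintedUV3V' N L` HOLDS. [cite: Balaban1985UV3, Thm 1 p.257 (compact reading) and Thm 2 p.272; Balaban1987RG1, (0.4)–(0.9) p.253 (bookkeeping)] -/
theorem printedUV3V'_of_s_N08_record₁₁CB10YZWB8 (hS : S_N08 (fun F D w => IsRecordOfRecord₁₁CB10YZWB8 F N D w))
    (h : IsRecordOfRecord₁₁CB10YZWB8 F N D w) {L : ℕ} (hL : w.L = (L : ℝ))
    {P : B12.RunParams} (h8 : (leavesP w P).b8) (h9 : (leavesP w P).b9) (h11 : (leavesP w P).b11) : PrintedUV3V' N L :=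
  s_N08_record₁₁CB10YZWB8_imp_primed hS F D w h L hL P h8 h9 h11

end Primed

/-! ## §B WHY THE KEY IS THE PINNED RECORD — over the route's own `Rec = IsRecordOfRecord₁₁C` the [B10] run family is the FREE residual field `θ.res.X` (the ₁₁ twin of
`B10LeafUnpinnedRecord5C` §0–§3, under ₁₁C-inhabitation at `F` as HYPOTHESIS — the route's K0 at the family, never asserted) -/

section Unpinned

variable {F : T4Family}

/-- **In-edge guards at every run of a STAGE-11 record** (the route's `Rec`): the leaves `b4`, `b5`, `b6`, `b7` HOLD — N01, N02, N03, N04 are NODE 00 theorems at the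
Stage-5 shadow (`Node00.b4∕b5∕b7_main_of_isRecordOfRecord₅C`, `Node00.N03_at_record₅C`), transferred by def-T's `Node00.atWorld_of_isRecordOfRecord₁₁C`.
[cite: Balaban1983RegularityDecay, Theorem p.573; Balaban1984PropagatorsI, Props. 1.1–1.2 pp.33–36; Balaban1984PropagatorsII, Lemma 2.1 – Cor. 2.8 pp.234–249; Balaban1985Averaging, Props. 1–10 pp.26–50 (kernel versions at the objects of record; bookkeeping, transferred)] -/
theorem guards_of_isRecordOfRecord₁₁C {D : Datum F N} {w : WorldP} (h : IsRecordOfRecord₁₁C F N D w) (P : B12.RunParams) :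
    (leavesP w P).b4 ∧ (leavesP w P).b5 ∧ (leavesP w P).b6 ∧ (leavesP w P).b7 :=
  atWorld_of_isRecordOfRecord₁₁C (X := fun ℓ => ℓ.b4 ∧ ℓ.b5 ∧ ℓ.b6 ∧ ℓ.b7)
    (fun _ _ h5 Q =>
      have h4 := b4_main_of_isRecordOfRecord₅C h5 Q
      have h5' := b5_main_of_isRecordOfRecord₅C h5 Q h4
      ⟨h4, h5', N03_at_record₅C h5 Q h4 h5', b7_main_of_isRecordOfRecord₅C h5 Q h5'⟩)
    h P

/-- The Stage-11 provisos read no carrier: they transport along ANY re-binding of the run-indexed bundle `X` (g31's `Stage11Params.rebindX`), field by field with EXPLICIT proofs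
(the shape of g31's `Provisos₁₁.pinB10`, at a generic `X′`). [cite: Balaban1988Convergent, (3.2)–(3.9) pp.265–266, (2.23)–(2.42) pp.259–262; Balaban1987RG1, (0.19) p.255 (the displayed provisos; bookkeeping)] -/
theorem provisos₁₁_rebindX {θ : Stage11Params F N} (h : θ.Provisos₁₁) (X' : B12.RunParams → PrintedCarriersR) : (θ.rebindX F N X').Provisos₁₁ :=
  ⟨⟨h.base.intPiece, h.base.measω, h.base.measChi, h.base.zetaUnity, h.base.zetaAbs, fun p k _ hk => h.base.rstep p k hk, h.base.contT⟩,
    h.rzLaws, h.wtLaws, h.alphaPos, h.bg⟩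

/-- Admissibility reads no carrier either (`Iff.rfl`). [cite: Balaban1987RG1, (1.20)–(1.21) p.264 (hypothesis dictionary; bookkeeping)] -/
theorem admissible_rebindX_iff (θ : Stage11Params F N) (X' : B12.RunParams → PrintedCarriersR) : (θ.rebindX F N X').Admissible ↔ θ.Admissible := Iff.rfl

/-- **EVERY carrier bundle occurs as the residual `X` of some Stage-11 record, GIVEN ONE** (₁₁ twin of `B10LeafUnpinnedRecord5C.exists_isRecordOfRecord₅C_b10_iff`): if the ₁₁C class is
inhabited at `F` by `(D, w)`, then for any `Xc` the SAME datum `D` with the world re-bound over `θ.rebindX (fun _ => Xc)` is a ₁₁C record whose `b10` leaf is, at every run, the compact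
node over `Xc`'s run family (`Node00.upOfRecord₅C_b10_iff`; `residualOfStage11` keeps `X`, `carriers₃` keeps the [B10] group).  A probe of the TYPING, not a statement about Bałaban's
densities. [cite: Balaban1985UV3, Thm 1 p.257 (compact reading) + Thm 2 p.272; Balaban1989LargeFieldII, Thm 1 + (0.1) pp.355–356 (bookkeeping over def-T's Stage-11 record predicate)] -/
theorem exists_isRecordOfRecord₁₁C_b10_iff (hK0 : ∃ (D : Datum F N) (w : WorldP), IsRecordOfRecord₁₁C F N D w) (Xc : PrintedCarriersR) :
    ∃ (D : Datum F N) (w : WorldP), IsRecordOfRecord₁₁C F N D w ∧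
      ∀ P : B12.RunParams, ((leavesP w P).b10 ↔ B10.Thm1PrintedCompact Xc.runs10 ∧ B10.Thm2Printed Xc.runs10) := by
  obtain ⟨D, w, θ, hP, hθ, hD, hC, hγ, hL, -⟩ := hK0
  refine ⟨D, { w with up := fun P => upOfRecord₅C F N ((θ.rebindX F N fun _ => Xc).toStage5₁₁ F N) P },
    ⟨θ.rebindX F N fun _ => Xc, provisos₁₁_rebindX hP _, hθ, ?_, hC, hγ, hL, fun _ => rfl⟩, fun P => ?_⟩
  · rw [datumOfRecord₁₁_rebindX F N θ hP]
    exact hD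
  · exact upOfRecord₅C_b10_iff F N _ P

/-- **At some Stage-11 record the `b10` leaf FAILS at every run** (given one ₁₁C record at `F`): the record of the probe above around a DEGENERATE bundle with ONE [B10] run whose
(41)∕(47) slot is `False` (`K = 0`), so `Thm2Printed` fails at `k = 0`. [cite: Balaban1985UV3, Thm 2 p.272 (bookkeeping: the typed leaf over a degenerate residual run family)] -/
theorem exists_isRecordOfRecord₁₁C_not_b10 (hK0 : ∃ (D : Datum F N) (w : WorldP), IsRecordOfRecord₁₁C F N D w) :
    ∃ (D : Datum F N) (w : WorldP), IsRecordOfRecord₁₁C F N D w ∧ ∀ P : B12.RunParams, ¬ (leavesP w P).b10 := by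
  obtain ⟨X₀⟩ := nonempty_printedCarriersR
  obtain ⟨D, w, hrec, hb10⟩ := exists_isRecordOfRecord₁₁C_b10_iff hK0
    { X₀ with
      I10 := PUnit
      runs10 := fun _ =>
        { K := 0, Cfg := fun _ => PUnit, ρ := fun _ _ => 0, χ := fun _ _ => 0, wilsonBG := fun _ _ => 0, sites := fun _ => 0,
          g := fun _ => 0, Ineq41_47 := fun _ => False } }
  exact ⟨D, w, hrec, fun P h => ((hb10 P).1 h).2 PUnit.unit 0 le_rfl⟩

/-- **At some Stage-11 record the `b10` leaf HOLDS at every run** (given one ₁₁C record at `F`) — DEGENERATELY: the EMPTY [B10] run family, Theorem 1 (compact) ∧ Theorem 2 vacuous.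
[cite: Balaban1985UV3, Thm 1 p.257 (typing; bookkeeping witness)] -/
theorem exists_isRecordOfRecord₁₁C_b10 (hK0 : ∃ (D : Datum F N) (w : WorldP), IsRecordOfRecord₁₁C F N D w) :
    ∃ (D : Datum F N) (w : WorldP), IsRecordOfRecord₁₁C F N D w ∧ ∀ P : B12.RunParams, (leavesP w P).b10 := by
  obtain ⟨X₀⟩ := nonempty_printedCarriersR
  obtain ⟨D, w, hrec, hb10⟩ := exists_isRecordOfRecord₁₁C_b10_iff hK0 { X₀ with I10 := PEmpty, runs10 := fun i => nomatch i }
  exact ⟨D, w, hrec, fun P => (hb10 P).2 ⟨fun _ _ _ _ => ⟨0, fun i => nomatch i⟩, fun i => nomatch i⟩⟩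

/-- **Hence, at the failing record, N08 FAILS as soon as N06, N05, N07 hold there** (`b4`, `b5`, `b6`, `b7` are theorems at every Stage-11 record — `guards_of_isRecordOfRecord₁₁C` —, the
three sisters supply `b9`, `b8`, `b11`, and `Dag.B10_main` would force the false leaf).  At ₁₁C the sisters' groups [B9] ∕ [B8] ∕ [B11] are residual too, so their ∀-forms over ₁₁C
are equally junk-able: a probe of the typing. [cite: Balaban1985UV3, Thm 1 p.257 + Thm 2 p.272 (bookkeeping over the node shape `Dag.B10_main`)] -/
theorem exists_isRecordOfRecord₁₁C_sisters_imp_not_b10_main (hK0 : ∃ (D : Datum F N) (w : WorldP), IsRecordOfRecord₁₁C F N D w) :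
    ∃ (D : Datum F N) (w : WorldP), IsRecordOfRecord₁₁C F N D w ∧
      ∀ P : B12.RunParams, Dag.B9_main (leavesP w P) → Dag.B8_main (leavesP w P) → Dag.B11_main (leavesP w P) → ¬ Dag.B10_main (leavesP w P) := by
  obtain ⟨D, w, hrec, hb10⟩ := exists_isRecordOfRecord₁₁C_not_b10 hK0
  refine ⟨D, w, hrec, fun P h9 h8 h11 h10 => hb10 P ?_⟩
  obtain ⟨h4, h5, h6, h7⟩ := guards_of_isRecordOfRecord₁₁C hrec P
  have h9' : (leavesP w P).b9 := h9 h4 h5 h6 h7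
  have h8' : (leavesP w P).b8 := h8 h5 h6 h7 h9'
  have h11' : (leavesP w P).b11 := h11 h5 h6 h7 h8' h9'
  exact h10 h5 h6 h7 h8' h9' h11'

/-- **Were N05, N06, N07 closed over the route's `Rec = IsRecordOfRecord₁₁C` as ∀-forms, N08's ∀-form over it would be REFUTABLE at every family where ₁₁C is inhabited** — the sharp
form of «N08's currency at ₁₁ is the PINNED key, not the unpinned record»; the K1 item is an ∃-form and is served at the pin (`N08AtRecord11.exists_isRecordOfRecord₁₁C_b10_main_of_printedUV3V`
of the companion module). [cite: Balaban1985UV3, Thm 1 p.257 + Thm 2 p.272 (bookkeeping)] -/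
theorem not_s_N08_record₁₁C_of_sisters (hK0 : ∃ (D : Datum F N) (w : WorldP), IsRecordOfRecord₁₁C F N D w)
    (h5 : S_N05 (fun F D w => IsRecordOfRecord₁₁C F N D w)) (h6 : S_N06 (fun F D w => IsRecordOfRecord₁₁C F N D w))
    (h7 : S_N07 (fun F D w => IsRecordOfRecord₁₁C F N D w)) : ¬ S_N08 (fun F D w => IsRecordOfRecord₁₁C F N D w) := by
  obtain ⟨D, w, hrec, h⟩ := exists_isRecordOfRecord₁₁C_sisters_imp_not_b10_main hK0
  exact fun h8 => h ⟨0, 0, 0⟩ (h6 F D w hrec _) (h5 F D w hrec _) (h7 F D w hrec _) (h8 F D w hrec _)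

/-- **THE STAGE-11 RECORD PREDICATE (C-binding, unpinned carriers) DOES NOT DECIDE LEAF `b10`** (both witnesses side by side, given one record at `F`): the [B10] group must be read
at a PINNED key — `IsRecordOfRecord₁₁CB10YZW` ∕ `IsRecordOfRecord₁₁CB10YZWB8`, whose records ARE ₁₁C records (same datum) and whose `b10` leaf IS the slot of record.
[cite: Balaban1985UV3, Thm 1 p.257, Thm 2 p.272 (bookkeeping)] -/
theorem b10_main_undetermined_over_record₁₁C (hK0 : ∃ (D : Datum F N) (w : WorldP), IsRecordOfRecord₁₁C F N D w) :
    (∃ (D : Datum F N) (w : WorldP), IsRecordOfRecord₁₁C F N D w ∧ ∀ P : B12.RunParams, Dag.B10_main (leavesP w P)) ∧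
      (∃ (D : Datum F N) (w : WorldP), IsRecordOfRecord₁₁C F N D w ∧
        ∀ P : B12.RunParams, Dag.B9_main (leavesP w P) → Dag.B8_main (leavesP w P) → Dag.B11_main (leavesP w P) → ¬ Dag.B10_main (leavesP w P)) := by
  refine ⟨?_, exists_isRecordOfRecord₁₁C_sisters_imp_not_b10_main hK0⟩
  obtain ⟨D, w, hrec, hb10⟩ := exists_isRecordOfRecord₁₁C_b10 hK0
  exact ⟨D, w, hrec, fun P _ _ _ _ _ _ => hb10 P⟩

end Unpinned

end Summit.QuantumFields.YangMills.BalabanUVNodes.N08AtRecord11Sides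

end
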